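import Summits.Parity.GeneralizedHardyLittlewood.Theorems.PrimeLevelFamEdgeMomentsBeyondDiagonalDiagBoseInner
import Mathlib.MeasureTheory.Integral.Prod
import HarnessLib

/-!
# Route `PrimeLevelFamEdge`, crux K_A `MomentsBeyondDiagonal` (stmt-Parity-20007), line «petersson_layers» v4, stub `stub_diag`:
# THE BOSE DOUBLE INTEGRAL IS A POLYNOMIAL IN THE LOG SHIFTS WITH UNIVERSAL COEFFICIENTS `c_{ab}(y)` (census R2, structure)

`𝔚_{ij}(A₁,A₂;y) = ∫_{u₁>0}(A₁+log u₁)^i ∫_{u₂>y/u₁} e^{−φ}(1−e^{−φ})^{−2}(A₂+log u₂)^j` (`…DiagLineSum`) is, for `y > 0`,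
`Σ_{a≤i} Σ_{b≤j} C(i,a)C(j,b) A₁^{i−a}A₂^{j−b} c_{ab}(y)`, `c_{ab}(y) = ∫_{u₁>0}(log u₁)^a ∫_{u₂>y/u₁} e^{−φ}(1−e^{−φ})^{−2}(log u₂)^b`
(`bose_expand`). In the diagonal part (`…DiagBoxTailFinal`: `diagPart` = explicit line series + `O(1)`) the shifts are
`A_ν = log q̂ − log(d_νe_ν)` and `y = K/q̂²`, so the main term of `stub_diag` is reduced to (i) the small-`y` behaviour of the
finitely many functions `c_{ab}` (R2 proper; `c₀₀ = Corner.scriptW`, `…DiagBoseZero`) and (ii) the five-variable Möbius sums (R3).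
Ingredients: the inner expansion and domination of `…DiagBoseInner`, measurability of the parametric inner integral via the product
(`StronglyMeasurable.integral_prod_right`), integrability against `e^{−u₁}|log u₁|^a`.
Helper `--supports stmt-Parity-20007`; closes nothing; K_A, K_B and the Parity summit are NOT proved; nothing about Landau–Siegel zeros.
-/

noncomputable section

open Real Set MeasureTheory Filter Finset Function
open Literature.NumberTheory.LFunctions

namespace Summit.Parity.GeneralizedHardyLittlewood.Theorems.MomentsBeyondDiagonal.DiagLines

/-- The inner Bose integral as an integral over `ℝ` of a jointly measurable function (for `u₁ > 0`:
`u₂ > y/u₁ ↔ y < u₁u₂`). [folklore] -/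
theorem bose_inner_eq_integral_ite {y u₁ : ℝ} (hu₁ : 0 < u₁) (b : ℕ) :
    ∫ u₂ in Ioi (y / u₁), Real.exp (-(u₁ + u₂)) / (1 - Real.exp (-(u₁ + u₂))) ^ 2 * Real.log u₂ ^ b =
      ∫ u₂, (if y < u₁ * u₂ then Real.exp (-(u₁ + u₂)) / (1 - Real.exp (-(u₁ + u₂))) ^ 2 * Real.log u₂ ^ b else 0) := by
  rw [← integral_indicator measurableSet_Ioi]
  refine integral_congr_ae (ae_of_all _ fun u₂ ↦ ?_)
  have hiff : y / u₁ < u₂ ↔ y < u₁ * u₂ := by rw [div_lt_iff₀ hu₁, mul_comm u₂ u₁]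
  simp only [Set.indicator, Set.mem_Ioi, hiff]

/-- Joint measurability of the Bose integrand with the region indicator. [folklore] -/
theorem measurable_bose_ite (y : ℝ) (b : ℕ) :
    Measurable (uncurry fun u₁ u₂ : ℝ ↦
      (if y < u₁ * u₂ then Real.exp (-(u₁ + u₂)) / (1 - Real.exp (-(u₁ + u₂))) ^ 2 * Real.log u₂ ^ b else 0)) := by
  have h1 : Measurable fun p : ℝ × ℝ ↦ Real.exp (-(p.1 + p.2)) / (1 - Real.exp (-(p.1 + p.2))) ^ 2 * Real.log p.2 ^ b :=
    ((Real.measurable_exp.comp (measurable_fst.add measurable_snd).neg).div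
      ((measurable_const.sub (Real.measurable_exp.comp (measurable_fst.add measurable_snd).neg)).pow_const 2)).mul
      ((Real.measurable_log.comp measurable_snd).pow_const b)
  refine Measurable.ite ?_ h1 measurable_const
  exact measurableSet_lt measurable_const (measurable_fst.mul measurable_snd)

/-- **Measurability of the parametric inner Bose integral** `u₁ ↦ ∫_{u₂>y/u₁} e^{−φ}(1−e^{−φ})^{−2}(log u₂)^b du₂` on `u₁ > 0`. [folklore] -/
theorem aestronglyMeasurable_bose_inner (y : ℝ) (b : ℕ) :
    AEStronglyMeasurable (fun u₁ : ℝ ↦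
      ∫ u₂ in Ioi (y / u₁), Real.exp (-(u₁ + u₂)) / (1 - Real.exp (-(u₁ + u₂))) ^ 2 * Real.log u₂ ^ b)
      (volume.restrict (Ioi 0)) := by
  have hsm := ((measurable_bose_ite y b).stronglyMeasurable).integral_prod_right (ν := (volume : Measure ℝ))
  refine (hsm.aestronglyMeasurable.mono_measure Measure.restrict_le_self).congr ?_
  rw [Filter.EventuallyEq, ae_restrict_iff' measurableSet_Ioi]
  exact ae_of_all _ fun u₁ (hu₁ : 0 < u₁) ↦ (bose_inner_eq_integral_ite hu₁ b).symm

/-- **Bound for the inner Bose integral**: for `y > 0`, `u₁ > 0`,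
`|∫_{u₂>y/u₁} e^{−φ}(1−e^{−φ})^{−2}(log u₂)^b| ≤ (1−e^{−√y})^{−2} e^{−u₁} ∫_0^∞ e^{−u}|log u|^b`. [folklore] -/
theorem abs_bose_inner_le {y u₁ : ℝ} (hy : 0 < y) (hu₁ : 0 < u₁) (b : ℕ) :
    |∫ u₂ in Ioi (y / u₁), Real.exp (-(u₁ + u₂)) / (1 - Real.exp (-(u₁ + u₂))) ^ 2 * Real.log u₂ ^ b| ≤
      ((1 - Real.exp (-Real.sqrt y)) ^ 2)⁻¹ * Real.exp (-u₁) *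
        ∫ u in Ioi (0 : ℝ), Real.exp (-u) * |(0 : ℝ) + Real.log u| ^ b := by
  have hz : 0 < y / u₁ := div_pos hy hu₁
  have hint := integrableOn_exp_neg_mul_abs_logPow (0 : ℝ) b
  have hintz : IntegrableOn (fun u : ℝ ↦ Real.exp (-u) * |(0 : ℝ) + Real.log u| ^ b) (Ioi (y / u₁)) :=
    hint.mono_set (Ioi_subset_Ioi hz.le)
  set K : ℝ := ((1 - Real.exp (-Real.sqrt y)) ^ 2)⁻¹ * Real.exp (-u₁) with hK
  have hK0 : 0 ≤ K := by rw [hK]; positivity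
  have hptw : ∀ u₂ ∈ Ioi (y / u₁), ‖Real.exp (-(u₁ + u₂)) / (1 - Real.exp (-(u₁ + u₂))) ^ 2 * Real.log u₂ ^ b‖ ≤
      K * (Real.exp (-u₂) * |(0 : ℝ) + Real.log u₂| ^ b) := by
    intro u₂ hu₂
    have hu₂ : y / u₁ < u₂ := hu₂
    have hB := bose_kernel_le hy hu₁ hu₂
    have hB0 : 0 ≤ Real.exp (-(u₁ + u₂)) / (1 - Real.exp (-(u₁ + u₂))) ^ 2 := div_nonneg (Real.exp_pos _).le (sq_nonneg _)
    rw [norm_mul, Real.norm_of_nonneg hB0, norm_pow, Real.norm_eq_abs, zero_add]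
    calc Real.exp (-(u₁ + u₂)) / (1 - Real.exp (-(u₁ + u₂))) ^ 2 * |Real.log u₂| ^ b
        ≤ ((1 - Real.exp (-Real.sqrt y)) ^ 2)⁻¹ * (Real.exp (-u₁) * Real.exp (-u₂)) * |Real.log u₂| ^ b := by gcongr
      _ = K * (Real.exp (-u₂) * |Real.log u₂| ^ b) := by rw [hK]; ring
  have hfint := integrableOn_bose_logPow hy hu₁ 0 b
  simp only [zero_add] at hfint
  calc |∫ u₂ in Ioi (y / u₁), Real.exp (-(u₁ + u₂)) / (1 - Real.exp (-(u₁ + u₂))) ^ 2 * Real.log u₂ ^ b|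
      ≤ ∫ u₂ in Ioi (y / u₁), ‖Real.exp (-(u₁ + u₂)) / (1 - Real.exp (-(u₁ + u₂))) ^ 2 * Real.log u₂ ^ b‖ := by
        rw [← Real.norm_eq_abs]; exact norm_integral_le_integral_norm _
    _ ≤ ∫ u₂ in Ioi (y / u₁), K * (Real.exp (-u₂) * |(0 : ℝ) + Real.log u₂| ^ b) :=
        setIntegral_mono_on hfint.norm (hintz.const_mul K) measurableSet_Ioi hptw
    _ = K * ∫ u₂ in Ioi (y / u₁), Real.exp (-u₂) * |(0 : ℝ) + Real.log u₂| ^ b := integral_const_mul _ _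
    _ ≤ K * ∫ u in Ioi (0 : ℝ), Real.exp (-u) * |(0 : ℝ) + Real.log u| ^ b := by
        refine mul_le_mul_of_nonneg_left ?_ hK0
        exact setIntegral_mono_set hint (ae_of_all _ fun u ↦ by positivity) (ae_of_all _ (Ioi_subset_Ioi hz.le))

/-- **Integrability of the `(a,b)` coefficient integrand**: `u₁ ↦ (log u₁)^a ∫_{u₂>y/u₁} e^{−φ}(1−e^{−φ})^{−2}(log u₂)^b` is
integrable on `u₁ > 0` (`y > 0`). [folklore] -/
theorem integrableOn_logPow_mul_bose_inner {y : ℝ} (hy : 0 < y) (a b : ℕ) :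
    IntegrableOn (fun u₁ : ℝ ↦ Real.log u₁ ^ a *
      ∫ u₂ in Ioi (y / u₁), Real.exp (-(u₁ + u₂)) / (1 - Real.exp (-(u₁ + u₂))) ^ 2 * Real.log u₂ ^ b) (Ioi 0) := by
  set Mb : ℝ := ∫ u in Ioi (0 : ℝ), Real.exp (-u) * |(0 : ℝ) + Real.log u| ^ b with hMb
  set Cy : ℝ := ((1 - Real.exp (-Real.sqrt y)) ^ 2)⁻¹ with hCy
  have hmaj : IntegrableOn (fun u₁ : ℝ ↦ (Cy * Mb) * (Real.exp (-u₁) * |(0 : ℝ) + Real.log u₁| ^ a)) (Ioi 0) :=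
    (integrableOn_exp_neg_mul_abs_logPow (0 : ℝ) a).const_mul _
  have hmeas : AEStronglyMeasurable (fun u₁ : ℝ ↦ Real.log u₁ ^ a *
      ∫ u₂ in Ioi (y / u₁), Real.exp (-(u₁ + u₂)) / (1 - Real.exp (-(u₁ + u₂))) ^ 2 * Real.log u₂ ^ b)
      (volume.restrict (Ioi 0)) :=
    ((Real.measurable_log.pow_const a).aestronglyMeasurable).mul (aestronglyMeasurable_bose_inner y b)
  refine Integrable.mono' hmaj hmeas ?_
  rw [ae_restrict_iff' measurableSet_Ioi]
  refine ae_of_all _ fun u₁ (hu₁ : 0 < u₁) ↦ ?_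
  have h := abs_bose_inner_le hy hu₁ b
  rw [norm_mul, norm_pow, Real.norm_eq_abs, Real.norm_eq_abs, zero_add]
  calc |Real.log u₁| ^ a * |∫ u₂ in Ioi (y / u₁), Real.exp (-(u₁ + u₂)) / (1 - Real.exp (-(u₁ + u₂))) ^ 2 * Real.log u₂ ^ b|
      ≤ |Real.log u₁| ^ a * (Cy * Real.exp (-u₁) * Mb) := by
        refine mul_le_mul_of_nonneg_left ?_ (pow_nonneg (abs_nonneg _) _)
        rw [hCy, hMb]; exact h
    _ = Cy * Mb * (Real.exp (-u₁) * |Real.log u₁| ^ a) := by ring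

/-- **THE BOSE DOUBLE INTEGRAL IS A POLYNOMIAL IN THE LOG SHIFTS** (census R2, structure): for `y > 0`, all `A₁, A₂`, `i, j`,
`∫_{u₁>0}(A₁+log u₁)^i ∫_{u₂>y/u₁} e^{−φ}(1−e^{−φ})^{−2}(A₂+log u₂)^j
   = Σ_{a≤i} Σ_{b≤j} C(i,a) C(j,b) A₁^{i−a} A₂^{j−b} · ∫_{u₁>0}(log u₁)^a ∫_{u₂>y/u₁} e^{−φ}(1−e^{−φ})^{−2}(log u₂)^b` (`φ = u₁+u₂`).
[cite: KowalskiMichelVanderKam2000, (21)–(23) p. 12–13 — derivation] -/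
theorem bose_expand {y : ℝ} (hy : 0 < y) (i j : ℕ) (A₁ A₂ : ℝ) :
    ∫ u₁ in Ioi (0 : ℝ), (A₁ + Real.log u₁) ^ i *
        ∫ u₂ in Ioi (y / u₁), Real.exp (-(u₁ + u₂)) / (1 - Real.exp (-(u₁ + u₂))) ^ 2 * (A₂ + Real.log u₂) ^ j =
      ∑ a ∈ Finset.range (i + 1), ∑ b ∈ Finset.range (j + 1),
        (i.choose a : ℝ) * (j.choose b : ℝ) * A₁ ^ (i - a) * A₂ ^ (j - b) *
          ∫ u₁ in Ioi (0 : ℝ), Real.log u₁ ^ a *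
            ∫ u₂ in Ioi (y / u₁), Real.exp (-(u₁ + u₂)) / (1 - Real.exp (-(u₁ + u₂))) ^ 2 * Real.log u₂ ^ b := by
  -- pointwise expansion of the integrand on `u₁ > 0`
  have hptw : ∀ u₁ ∈ Ioi (0 : ℝ), (A₁ + Real.log u₁) ^ i *
        ∫ u₂ in Ioi (y / u₁), Real.exp (-(u₁ + u₂)) / (1 - Real.exp (-(u₁ + u₂))) ^ 2 * (A₂ + Real.log u₂) ^ j =
      ∑ a ∈ Finset.range (i + 1), ∑ b ∈ Finset.range (j + 1),
        (i.choose a : ℝ) * (j.choose b : ℝ) * A₁ ^ (i - a) * A₂ ^ (j - b) *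
          (Real.log u₁ ^ a *
            ∫ u₂ in Ioi (y / u₁), Real.exp (-(u₁ + u₂)) / (1 - Real.exp (-(u₁ + u₂))) ^ 2 * Real.log u₂ ^ b) := by
    intro u₁ hu₁
    have hu₁ : 0 < u₁ := hu₁
    rw [bose_inner_expand hy hu₁ A₂ j, add_comm A₁, add_pow, Finset.sum_mul]
    refine Finset.sum_congr rfl fun a _ ↦ ?_
    rw [Finset.mul_sum]
    refine Finset.sum_congr rfl fun b _ ↦ ?_
    ring
  rw [setIntegral_congr_fun measurableSet_Ioi hptw,
    integral_finsetSum _ fun a _ ↦ integrable_finsetSum _ fun b _ ↦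
      ((integrableOn_logPow_mul_bose_inner hy a b).const_mul _)]
  refine Finset.sum_congr rfl fun a _ ↦ ?_
  rw [integral_finsetSum _ fun b _ ↦ (integrableOn_logPow_mul_bose_inner hy a b).const_mul _]
  refine Finset.sum_congr rfl fun b _ ↦ ?_
  exact integral_const_mul _ _

end Summit.Parity.GeneralizedHardyLittlewood.Theorems.MomentsBeyondDiagonal.DiagLines

end
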